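import Literature.Probability.Percolation.TrackExchangeStrip
import Literature.Probability.Percolation.IsoradialPathCrossing
import Literature.Probability.Percolation.IsoradialSquareLatticeGMTiling
import Literature.Probability.Percolation.IsoradialBoxBootstrap
import Literature.Probability.LatticeModels.ProdBernoulliClusterLocality
import Literature.Probability.Percolation.SeedLemma
import HarnessLib

/-!
# Open lattice walks of `ℤ²` in diamond coordinates, box crossings, and GM14 (6.12)

Grimmett–Manolescu, *Bond percolation on isoradial graphs* (PTRF 159 (2014) 273–327 =
arXiv:1204.0505), §4.6: the boxes `B(M₁, M₂; N₁, N₂) = {v_{i,j} : M₁ ≤ i ≤ M₂, N₁ ≤ j ≤ N₂}` of an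
isoradial square lattice and their crossings `C_h[B]`, `C_v[B]` ("a horizontal crossing of `B` is an
open path of `B` linking some `v_{M₁,n₁}` to some `v_{M₂,n₂}`"), which carry the whole of §6
("use of the notation `B` emphasizes that domains are defined in terms of tracks at specific
levels"). These boxes are combinatorial: they do not depend on the angles `α, β` — only the
measure `P_{α,β} = prodBernoulli (gmWeight α β)` (`IsoradialSquareLatticeGM`) does.

This file is the light-weight common layer of the §6 assembly (no track exchanges):

* `IsLatticeWalk`, `col`, `hgtOf` — open walks of `ℤ²` as lists, diamond coordinates
  `(i, j) = (x₀ - x₁, x₀ + x₁)`; the four events of the two transports: `initEventGM` (GM14's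
  `E_N`), `finalEventGM` (Prop. 6.4), `cvInitGM = C_v[B(N,N)]`, `cvFinalGM` (Prop. 6.8); their
  measurability and locality (`DeterminedBy` the edges between their heights), and
  `gmWeight_eq_of_rows` (the weight of an edge depends on the row sequence only through its row);
* `exists_openConnIn_le_level` / `…_clip` — clipping an open connection at a level of an integer
  `1`-Lipschitz function (columns and heights move by one along an edge);
* `zDia` — the straight drawing `x ↦ i + j·𝐢`; it is the rhombic embedding `G_{0,π/2}`
  (`zDia_eq_gmEmbedding_z`), an isoradial rhombic tiling, so the tree's Euclidean events
  `embRectCrossing` / `embTBCrossing` / `openCrossing` for `zDia` are the index-box crossings of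
  every `G_{α,β}`, and the tree's planar crossing lemma applies to them;
* the event dictionary (`embTBCrossing_subset_cvInitGM`, `cvFinalGM_subset_embTBCrossing`,
  `openCrossing_subset_initEventGM`, `finalEventGM_subset_embRectCrossing`), GM14 (6.12):
  `cornerCrossing_of_three` (planar gluing of `C_h` and two `C_v` into `E_N`) and
  `prod_three_le_measureReal_initEventGM` (Harris), and `AnglesIn ε α β` (GM14 (4.5)).

## References

* G. R. Grimmett, I. Manolescu, PTRF 159 (2014) 273–327, arXiv:1204.0505, §4.6, §6.2 ((6.11),
  (6.12)), §2.3 (Harris–FKG).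
-/

noncomputable section

namespace Literature.Probability.Percolation

open LatticeModels StarTriangle Real MeasureTheory Complex

namespace TrackExchange

/-! ### Open lattice walks and the four events -/

/-- An `ω`-open walk of `ℤ²`: consecutive sites are adjacent in `zdGraph 2` and joined by an
edge of `ω`. [folklore] -/
def IsLatticeWalk (ω : Set (Sym2 (Site 2))) : List (Site 2) → Prop
  | [] => True
  | [_] => True
  | a :: b :: l => ((zdGraph 2).Adj a b ∧ s(a, b) ∈ ω) ∧ IsLatticeWalk ω (b :: l)

/-- The diamond column of a site. [folklore] -/
def col (x : Site 2) : ℤ := x 0 - x 1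

/-- The diamond height of a site. [folklore] -/
def hgtOf (x : Site 2) : ℤ := x 0 + x 1

/-- **GM14's `E_N`** on `ℤ²`: an open path in the box `B(ρN, N) = {|i| ≤ ρN, 0 ≤ y ≤ N}`
(diamond coordinates) from some `v_{x₀,0}`, `x₀ ∈ [-ρN, -(ρ-1)N]`, to some `v_{x₁,0}`,
`x₁ ∈ [(ρ-1)N, ρN]`. [cite: GrimmettManolescu2014Isoradial, §6.2] -/
def initEventGM (ρ N : ℕ) : Set (Set (Sym2 (Site 2))) :=
  {ω | ∃ L : List (Site 2), IsLatticeWalk ω L ∧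
    (∃ a, L.head? = some a ∧ hgtOf a = 0 ∧ -((ρ * N : ℕ) : ℤ) ≤ col a ∧ col a ≤ -(((ρ - 1) * N : ℕ) : ℤ)) ∧
    (∃ b, L.getLast? = some b ∧ hgtOf b = 0 ∧ (((ρ - 1) * N : ℕ) : ℤ) ≤ col b ∧ col b ≤ ((ρ * N : ℕ) : ℤ)) ∧
    ∀ x ∈ L, |col x| ≤ ((ρ * N : ℕ) : ℤ) ∧ 0 ≤ hgtOf x ∧ hgtOf x ≤ N}

/-- **The target event on `ℤ²`**: an open path from some `v_{x₀,0}`, `x₀ ∈ [-ρN, -(ρ-1)N]`, to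
some `v_{x₁,0}`, `x₁ ∈ [(ρ-1)N, ρN]`, with all heights in `[0, K]` (it contains a horizontal
crossing of `B((ρ-1)N, K)`). [cite: GrimmettManolescu2014Isoradial, §6.2 (6.14)] -/
def finalEventGM (ρ N K : ℕ) : Set (Set (Sym2 (Site 2))) :=
  {ω | ∃ L : List (Site 2), IsLatticeWalk ω L ∧
    (∃ a, L.head? = some a ∧ hgtOf a = 0 ∧ -((ρ * N : ℕ) : ℤ) ≤ col a ∧ col a ≤ -(((ρ - 1) * N : ℕ) : ℤ)) ∧
    (∃ b, L.getLast? = some b ∧ hgtOf b = 0 ∧ (((ρ - 1) * N : ℕ) : ℤ) ≤ col b ∧ col b ≤ ((ρ * N : ℕ) : ℤ)) ∧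
    ∀ x ∈ L, 0 ≤ hgtOf x ∧ hgtOf x ≤ K}

/-- **A vertical crossing of `B(N, N)`** in diamond coordinates: an open path inside
`{|i| ≤ N, 0 ≤ y ≤ N}` from height `0` to height `N`. [cite: GrimmettManolescu2014Isoradial, §4.6] -/
def cvInitGM (N : ℕ) : Set (Set (Sym2 (Site 2))) :=
  {ω | ∃ L : List (Site 2), IsLatticeWalk ω L ∧ (∃ a, L.head? = some a ∧ hgtOf a = 0) ∧
    (∃ b, L.getLast? = some b ∧ hgtOf b = N) ∧ ∀ x ∈ L, |col x| ≤ N ∧ 0 ≤ hgtOf x ∧ hgtOf x ≤ N}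

/-- **The target vertical crossing**: an open path inside `{|i| ≤ 3N + u + 2, 0 ≤ y ≤ u}` from
height `0` to height `u`. [cite: GrimmettManolescu2014Isoradial, §6.3] -/
def cvFinalGM (N u : ℕ) : Set (Set (Sym2 (Site 2))) :=
  {ω | ∃ L : List (Site 2), IsLatticeWalk ω L ∧ (∃ a, L.head? = some a ∧ hgtOf a = 0) ∧
    (∃ b, L.getLast? = some b ∧ hgtOf b = u) ∧ ∀ x ∈ L, |col x| ≤ 3 * N + u + 2 ∧ 0 ≤ hgtOf x ∧ hgtOf x ≤ u}

end TrackExchange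

/-! ### Clipping open connections at a level of a `1`-Lipschitz function -/

section Clip

variable {V : Type*} {G : SimpleGraph V}

/-- **First visit to a level.** For a lattice configuration `ω ⊆ E(G)` and an integer function
`f` of the vertices changing by at most one along the edges of `G`, an open connection inside `S`
from `x` with `f x ≤ a` to `y` with `a ≤ f y` contains an open connection inside `S ∩ {f ≤ a}`
from `x` to a vertex `z` with `f z = a`. [folklore] -/
theorem exists_openConnIn_le_level {ω : BondConfig V} (hω : ω ⊆ G.edgeSet) (f : V → ℤ)
    (hf : ∀ u v, G.Adj u v → f v ≤ f u + 1) {S : Set V} {x y : V} (a : ℤ) (hx : f x ≤ a) (hy : a ≤ f y)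
    (h : ω ∈ openConnIn S x y) : ∃ z, f z = a ∧ ω ∈ openConnIn (S ∩ {z | f z ≤ a}) x z := by
  obtain ⟨hxS, hyS, ⟨p⟩⟩ := h
  suffices H : ∀ (u v : S) (p : ((openGraph ω).induce S).Walk u v), f u ≤ a → a ≤ f v →
      ∃ z, f z = a ∧ ω ∈ openConnIn (S ∩ {z | f z ≤ a}) u z from H ⟨x, hxS⟩ ⟨y, hyS⟩ p hx hy
  intro u v p
  induction p with
  | nil =>
    intro hu hv
    rename_i u
    exact ⟨u, le_antisymm hu hv, ⟨u.2, hu⟩, ⟨u.2, hu⟩, SimpleGraph.Reachable.refl _⟩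
  | cons hadj p ih =>
    intro hu hv
    rename_i u w v'
    rcases hu.eq_or_lt with hua | hua
    · exact ⟨u, hua, ⟨u.2, hu⟩, ⟨u.2, hu⟩, SimpleGraph.Reachable.refl _⟩
    · have hadj' : (openGraph ω).Adj u w := hadj
      have hw : f (w : V) ≤ a := by
        have hG : G.Adj (u : V) (w : V) := hω ((openGraph_adj _ _ _).1 hadj').1
        have := hf _ _ hG
        omega
      obtain ⟨z, hz, huS, hzS, hr⟩ := ih hw hv
      refine ⟨z, hz, ⟨u.2, hu⟩, hzS, ?_⟩
      refine SimpleGraph.Reachable.trans (SimpleGraph.Adj.reachable ?_) hr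
      simpa [SimpleGraph.induce_adj] using hadj'

/-- **Last visit to a level.** Symmetrically, the connection contains an open connection inside
`S ∩ {a ≤ f}` from a vertex `z` with `f z = a` to `y`. [folklore] -/
theorem exists_openConnIn_ge_level {ω : BondConfig V} (hω : ω ⊆ G.edgeSet) (f : V → ℤ)
    (hf : ∀ u v, G.Adj u v → f v ≤ f u + 1) {S : Set V} {x y : V} (a : ℤ) (hx : f x ≤ a) (hy : a ≤ f y)
    (h : ω ∈ openConnIn S x y) : ∃ z, f z = a ∧ ω ∈ openConnIn (S ∩ {z | a ≤ f z}) z y := by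
  rw [openConnIn_comm] at h
  obtain ⟨z, hz, hr⟩ := exists_openConnIn_le_level hω (fun v => -f v) (fun u v huv => by
    have := hf v u huv.symm; change -f v ≤ -f u + 1; omega) (-a) (by omega) (by omega) h
  have hz' : -f z = -a := hz
  refine ⟨z, by omega, ?_⟩
  rw [openConnIn_comm]
  have : S ∩ {z : V | a ≤ f z} = S ∩ {z : V | -f z ≤ -a} := by ext v; simp
  rw [this]; exact hr

/-- **Clipping to a window.** An open connection inside `S` from `x` with `f x ≤ a` to `y` with
`b ≤ f y`, `a ≤ b`, contains an open connection inside `S ∩ {a ≤ f ≤ b}` between vertices `x'`, `y'`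
with `f x' = a` and `f y' = b`. [folklore] -/
theorem exists_openConnIn_clip {ω : BondConfig V} (hω : ω ⊆ G.edgeSet) (f : V → ℤ)
    (hf : ∀ u v, G.Adj u v → f v ≤ f u + 1) {S : Set V} {x y : V} {a b : ℤ} (hab : a ≤ b) (hx : f x ≤ a)
    (hy : b ≤ f y) (h : ω ∈ openConnIn S x y) :
    ∃ x' y', f x' = a ∧ f y' = b ∧ ω ∈ openConnIn (S ∩ {z | a ≤ f z ∧ f z ≤ b}) x' y' := by
  obtain ⟨x', hx', h1⟩ := exists_openConnIn_ge_level hω f hf a hx (hab.trans hy) h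
  obtain ⟨y', hy', h2⟩ := exists_openConnIn_le_level hω f hf b (by omega) hy h1
  refine ⟨x', y', hx', hy', ?_⟩
  have : S ∩ {z : V | a ≤ f z} ∩ {z : V | f z ≤ b} = S ∩ {z : V | a ≤ f z ∧ f z ≤ b} := by
    ext v; simp [and_assoc]
  rw [← this]; exact h2

end Clip

/-! ### Diamond coordinates along the edges of `ℤ²` -/

namespace TrackExchange

/-- Along an edge of `ℤ²` the diamond column changes by exactly one. [folklore] -/
theorem col_le_of_adj (u v : Site 2) (h : (zdGraph 2).Adj u v) : col v ≤ col u + 1 := by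
  rw [zdGraph_adj_iff] at h
  obtain ⟨j, hj | hj⟩ := h <;>
  · have h0 := congrFun hj 0
    have h1 := congrFun hj 1
    fin_cases j <;> simp [col] at h0 h1 ⊢ <;> omega

/-- Along an edge of `ℤ²` the diamond height changes by exactly one. [folklore] -/
theorem hgtOf_le_of_adj (u v : Site 2) (h : (zdGraph 2).Adj u v) : hgtOf v ≤ hgtOf u + 1 := by
  rw [zdGraph_adj_iff] at h
  obtain ⟨j, hj | hj⟩ := h <;>
  · have h0 := congrFun hj 0
    have h1 := congrFun hj 1
    fin_cases j <;> simp [hgtOf] at h0 h1 ⊢ <;> omega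

/-- The support of a walk starts at its first endpoint. [folklore] -/
theorem head?_support {V : Type*} {G : SimpleGraph V} {x y : V} (p : G.Walk x y) : p.support.head? = some x := by
  cases p <;> rfl

/-- The support of a walk ends at its last endpoint. [folklore] -/
theorem getLast?_support {V : Type*} {G : SimpleGraph V} : ∀ {x y : V} (p : G.Walk x y), p.support.getLast? = some y
  | _, _, .nil => rfl
  | _, _, .cons _ q => by
    rw [SimpleGraph.Walk.support_cons, List.getLast?_cons, getLast?_support q]; rfl

/-! ### The straight drawing by diamond coordinates is `G_{0,π/2}` -/

/-- **The straight drawing of `ℤ²` by its diamond coordinates**: the site `x` at `i + j·𝐢`,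
`(i, j) = (x₀ - x₁, x₀ + x₁)`. [cite: GrimmettManolescu2014Isoradial, §4.6] -/
def zDia (x : Site 2) : ℂ := (col x : ℂ) + (hgtOf x : ℂ) * I

/-- Real part = column. [folklore] -/
@[simp] theorem zDia_re (x : Site 2) : (zDia x).re = col x := by simp [zDia]

/-- Imaginary part = height. [folklore] -/
@[simp] theorem zDia_im (x : Site 2) : (zDia x).im = hgtOf x := by simp [zDia]

/-- Real part of the translate by `-c`: column `+ c`. [folklore] -/
@[simp] theorem re_zDia_sub_neg (v : Site 2) (c : ℕ) : (zDia v - -((c : ℕ) : ℂ)).re = col v + c := by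
  simp [zDia]

/-- Imaginary part of the translate by `-c`: the height. [folklore] -/
@[simp] theorem im_zDia_sub_neg (v : Site 2) (c : ℕ) : (zDia v - -((c : ℕ) : ℂ)).im = hgtOf v := by
  simp [zDia]

/-- **The straight drawing is the isoradial square lattice `G_{0,π/2}`.** [cite: GrimmettManolescu2014Isoradial, §4.6] -/
theorem zDia_eq_gmEmbedding_z : (gmEmbedding (fun _ => (0 : ℝ)) (fun _ => π / 2)).z = zDia := by
  funext x
  rw [gmEmbedding_z]
  unfold gmVertex gmDiamond zDia col hgtOf
  rw [trackHeight_const, trackHeight_const]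
  simp [Complex.exp_mul_I, Complex.cos_pi_div_two, Complex.sin_pi_div_two]

/-- The angles of `G_{0,π/2}` satisfy (4.5) with `ε = π/8` in the tree's half-angle units. [folklore] -/
theorem angles_zero_pi_div_two : ∀ i j : ℤ, 2 * (π / 8) ≤ (fun _ : ℤ => π / 2) j - (fun _ : ℤ => (0 : ℝ)) i ∧
    (fun _ : ℤ => π / 2) j - (fun _ : ℤ => (0 : ℝ)) i ≤ π - 2 * (π / 8) := by
  intro i j; constructor <;> simp <;> linarith [Real.pi_pos]

/-- `G_{0,π/2}` is an isoradial embedding. [cite: GrimmettManolescu2014Isoradial, §4.6] -/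
theorem isIsoradial_dia : (gmEmbedding (fun _ => (0 : ℝ)) (fun _ => π / 2)).IsIsoradial :=
  isIsoradial_gmEmbedding fun i j => by constructor <;> simp <;> linarith [Real.pi_pos]

/-- `G_{0,π/2}` is a rhombic tiling. [cite: GrimmettManolescu2014Isoradial, §4.6] -/
theorem isRhombicTiling_dia : (gmEmbedding (fun _ => (0 : ℝ)) (fun _ => π / 2)).IsRhombicTiling :=
  isRhombicTiling_gmEmbedding (by positivity) angles_zero_pi_div_two

/-! ### List walks and open connections -/

/-- **A list walk gives an open connection** inside any set containing its vertices. [folklore] -/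
theorem openConnIn_of_isLatticeWalk {ω : Set (Sym2 (Site 2))} {S : Set (Site 2)} :
    ∀ {L : List (Site 2)} {a b : Site 2}, IsLatticeWalk ω L → L.head? = some a → L.getLast? = some b →
      (∀ x ∈ L, x ∈ S) → ω ∈ openConnIn S a b
  | [], _, _, _, ha, _, _ => by simp at ha
  | [v], a, b, _, ha, hb, hS => by
    simp only [List.head?_cons, Option.some.injEq] at ha
    simp only [List.getLast?_singleton, Option.some.injEq] at hb
    subst ha; subst hb
    exact ⟨hS v (by simp), hS v (by simp), SimpleGraph.Reachable.refl _⟩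
  | u :: v :: l, a, b, hL, ha, hb, hS => by
    simp only [List.head?_cons, Option.some.injEq] at ha
    subst ha
    have ih := openConnIn_of_isLatticeWalk (L := v :: l) (a := v) (b := b) hL.2 rfl
      (by rwa [List.getLast?_cons_cons] at hb) fun x hx => hS x (List.mem_cons_of_mem _ hx)
    obtain ⟨hvS, hbS, hr⟩ := ih
    have haS : u ∈ S := hS u (by simp)
    refine ⟨haS, hbS, SimpleGraph.Reachable.trans (SimpleGraph.Adj.reachable ?_) hr⟩
    simp only [SimpleGraph.induce_adj, openGraph_adj]
    exact ⟨hL.1.2, hL.1.1.ne⟩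

/-- **The support of a walk of `ℤ²` with open edges is a list walk.** [folklore] -/
theorem isLatticeWalk_support {ω : Set (Sym2 (Site 2))} : ∀ {x y : Site 2} (p : (zdGraph 2).Walk x y),
    (∀ e ∈ p.edges, e ∈ ω) → IsLatticeWalk ω p.support
  | _, _, .nil, _ => trivial
  | x, y, .cons (v := v) hadj q, hω => by
    have hq := isLatticeWalk_support q fun e he => hω e (by simp [he])
    rw [SimpleGraph.Walk.support_cons]
    cases hq' : q.support with
    | nil => exact absurd hq' (SimpleGraph.Walk.support_ne_nil q)
    | cons w l =>
      have hw : w = v := by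
        have := head?_support q
        rw [hq'] at this
        simp only [List.head?_cons, Option.some.injEq] at this
        exact this
      subst hw
      rw [hq'] at hq
      exact ⟨⟨hadj, hω _ (by simp)⟩, hq⟩

/-! ### The event dictionary of the two transports -/

/-- **Input of Proposition 6.8**: a top–bottom crossing of the rectangle `[-N, N] × [0, N]` of the
straight drawing (the tree's `embTBCrossing`, with its slack `2` in height) is, on lattice
configurations, a vertical crossing of `B(N, N)` (`cvInitGM`): clip the path at heights `0` and `N`.
[cite: GrimmettManolescu2014Isoradial, §6.3] -/
theorem embTBCrossing_subset_cvInitGM (N : ℕ) {ω : Set (Sym2 (Site 2))} (hω : ω ⊆ (zdGraph 2).edgeSet)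
    (h : ω ∈ embTBCrossing (fun v => zDia v - (-(N : ℂ))) (2 * N) N) : ω ∈ cvInitGM N := by
  obtain ⟨x, hx, y, hy, hxy⟩ := h
  simp only [Set.mem_setOf_eq, im_zDia_sub_neg] at hx hy
  obtain ⟨x', y', hx', hy', hconn⟩ := exists_openConnIn_clip hω hgtOf hgtOf_le_of_adj (a := 0) (b := N)
    (by positivity) (by exact_mod_cast hx) (by exact_mod_cast hy) hxy
  obtain ⟨p, hpS, hpω⟩ := exists_walk_of_mem_openConnIn hω hconn
  refine ⟨p.support, isLatticeWalk_support p hpω, ⟨x', head?_support p, hx'⟩, ⟨y', getLast?_support p, hy'⟩, fun v hv => ?_⟩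
  obtain ⟨⟨hre, -⟩, h1, h2⟩ := hpS v hv
  simp only [re_zDia_sub_neg, Set.mem_Icc] at hre
  obtain ⟨hre1, hre2⟩ := hre
  have i1 : (0 : ℤ) ≤ col v + N := by exact_mod_cast hre1
  have i2 : col v + N ≤ (2 * N : ℤ) := by exact_mod_cast hre2
  refine ⟨?_, h1, h2⟩
  rw [abs_le]; constructor <;> omega

/-- **Output of Proposition 6.8**: the target crossing `cvFinalGM N u` is a top–bottom crossing of
the rectangle `[-(3N+u+2), 3N+u+2] × [0, u]` of the straight drawing. [cite: GrimmettManolescu2014Isoradial, §6.3] -/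
theorem cvFinalGM_subset_embTBCrossing (N u : ℕ) :
    cvFinalGM N u ⊆ embTBCrossing (fun v => zDia v - (-((3 * N + u + 2 : ℕ) : ℂ))) (2 * (3 * N + u + 2 : ℕ)) u := by
  rintro ω ⟨L, hL, ⟨a, ha, ha0⟩, ⟨b, hb, hbu⟩, hbox⟩
  refine ⟨a, ?_, b, ?_, openConnIn_of_isLatticeWalk hL ha hb fun x hx => ?_⟩
  · simp only [Set.mem_setOf_eq, im_zDia_sub_neg, ha0, Int.cast_zero, le_refl]
  · simp only [Set.mem_setOf_eq, im_zDia_sub_neg, hbu, Int.cast_natCast, le_refl]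
  · obtain ⟨h1, h2, h3⟩ := hbox x hx
    rw [abs_le] at h1
    simp only [Set.mem_setOf_eq, re_zDia_sub_neg, im_zDia_sub_neg, Set.mem_Icc]
    have i1 : (0 : ℤ) ≤ col x + (3 * N + u + 2 : ℕ) := by push_cast; omega
    have i2 : col x + (3 * N + u + 2 : ℕ) ≤ (2 * (3 * N + u + 2 : ℕ) : ℤ) := by push_cast; omega
    have i3 : (-2 : ℤ) ≤ hgtOf x := by omega
    have i4 : hgtOf x ≤ (u : ℤ) + 2 := by omega
    refine ⟨⟨by exact_mod_cast i1, by exact_mod_cast i2⟩, by exact_mod_cast i3, by exact_mod_cast i4⟩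

/-- **GM14's `E_N` as an open crossing**: the open crossing of the box `B(ρN, N)` between its two
bottom corners `{v_{x,0} : -ρN ≤ x ≤ -(ρ-1)N}` and `{v_{x,0} : (ρ-1)N ≤ x ≤ ρN}` is, on lattice
configurations, the event `initEventGM ρ N` of `HorizontalTransportGM`. [cite: GrimmettManolescu2014Isoradial, §6.2] -/
theorem openCrossing_subset_initEventGM (ρ N : ℕ) {ω : Set (Sym2 (Site 2))} (hω : ω ⊆ (zdGraph 2).edgeSet)
    (h : ω ∈ openCrossing {v : Site 2 | |col v| ≤ ((ρ * N : ℕ) : ℤ) ∧ 0 ≤ hgtOf v ∧ hgtOf v ≤ N}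
      {v | hgtOf v = 0 ∧ -((ρ * N : ℕ) : ℤ) ≤ col v ∧ col v ≤ -(((ρ - 1) * N : ℕ) : ℤ)}
      {v | hgtOf v = 0 ∧ (((ρ - 1) * N : ℕ) : ℤ) ≤ col v ∧ col v ≤ ((ρ * N : ℕ) : ℤ)}) :
    ω ∈ initEventGM ρ N := by
  obtain ⟨x, hx, y, hy, hxy⟩ := h
  obtain ⟨p, hpS, hpω⟩ := exists_walk_of_mem_openConnIn hω hxy
  exact ⟨p.support, isLatticeWalk_support p hpω, ⟨x, head?_support p, hx⟩, ⟨y, getLast?_support p, hy⟩, fun v hv => hpS v hv⟩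

/-- **Output of Proposition 6.4**: the target event `finalEventGM ρ N K` (an open path between the
two bottom corners with all heights in `[0, K]`) gives, on lattice configurations with `ρ ≥ 1`, a
left–right crossing of the rectangle `[-(ρ-1)N, (ρ-1)N] × [0, K]` of the straight drawing (natural
subtraction: for `ρ = 0` the rectangle degenerates): clip the path at the columns `∓(ρ-1)N`. [cite: GrimmettManolescu2014Isoradial, §6.2 (6.14)] -/
theorem finalEventGM_subset_embRectCrossing (ρ N K : ℕ) {ω : Set (Sym2 (Site 2))}
    (hω : ω ⊆ (zdGraph 2).edgeSet) (h : ω ∈ finalEventGM ρ N K) :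
    ω ∈ embRectCrossing (fun v => zDia v - (-(((ρ - 1) * N : ℕ) : ℂ))) (2 * ((ρ - 1) * N : ℕ)) K := by
  obtain ⟨L, hL, ⟨a, ha, ha0, ha1, ha2⟩, ⟨b, hb, hb0, hb1, hb2⟩, hbox⟩ := h
  have hconn : ω ∈ openConnIn {v : Site 2 | 0 ≤ hgtOf v ∧ hgtOf v ≤ K} a b :=
    openConnIn_of_isLatticeWalk hL ha hb fun x hx => hbox x hx
  set m : ℤ := (((ρ - 1) * N : ℕ) : ℤ) with hm
  obtain ⟨x', y', hx', hy', hconn'⟩ := exists_openConnIn_clip hω col col_le_of_adj (a := -m) (b := m)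
    (by omega) (by omega) hb1 hconn
  refine ⟨x', ?_, y', ?_, openConnIn_mono (fun v hv => ?_) _ _ hconn'⟩
  · show (zDia x' - -((((ρ - 1) * N : ℕ) : ℂ))).re ≤ 0
    rw [re_zDia_sub_neg]
    have : col x' + (((ρ - 1) * N : ℕ) : ℤ) ≤ 0 := by omega
    exact_mod_cast this
  · show (2 * ((ρ - 1) * N : ℕ) : ℝ) ≤ (zDia y' - -((((ρ - 1) * N : ℕ) : ℂ))).re
    rw [re_zDia_sub_neg]
    have : (2 * ((ρ - 1) * N : ℕ) : ℤ) ≤ col y' + (((ρ - 1) * N : ℕ) : ℤ) := by omega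
    exact_mod_cast this
  · obtain ⟨⟨h1, h2⟩, h3, h4⟩ := hv
    simp only [Set.mem_setOf_eq, re_zDia_sub_neg, im_zDia_sub_neg, Set.mem_Icc]
    have i1 : (-2 : ℤ) ≤ col v + (((ρ - 1) * N : ℕ) : ℤ) := by omega
    have i2 : col v + (((ρ - 1) * N : ℕ) : ℤ) ≤ 2 * (((ρ - 1) * N : ℕ) : ℤ) + 2 := by omega
    exact ⟨⟨by exact_mod_cast i1, by exact_mod_cast i2⟩, by exact_mod_cast h1, by exact_mod_cast h2⟩


/-! ### Measurability -/

/-- The event that a given list is an open lattice walk is measurable. [folklore] -/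
theorem measurableSet_setOf_isLatticeWalk : ∀ L : List (Site 2), MeasurableSet {ω : Set (Sym2 (Site 2)) | IsLatticeWalk ω L}
  | [] => by simp [IsLatticeWalk]
  | [_] => by simp [IsLatticeWalk]
  | a :: b :: l => by
    have h : {ω : Set (Sym2 (Site 2)) | IsLatticeWalk ω (a :: b :: l)} =
        ({ω | (zdGraph 2).Adj a b} ∩ {ω | s(a, b) ∈ ω}) ∩ {ω | IsLatticeWalk ω (b :: l)} := by
      ext ω; simp [IsLatticeWalk, and_assoc]
    rw [h]
    exact ((MeasurableSet.const _).inter (measurableSet_mem _)).inter (measurableSet_setOf_isLatticeWalk (b :: l))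

/-- A walk event `{∃ L, IsLatticeWalk ω L ∧ Q L}` is measurable. [folklore] -/
theorem measurableSet_exists_isLatticeWalk (Q : List (Site 2) → Prop) :
    MeasurableSet {ω : Set (Sym2 (Site 2)) | ∃ L, IsLatticeWalk ω L ∧ Q L} := by
  have h : {ω : Set (Sym2 (Site 2)) | ∃ L, IsLatticeWalk ω L ∧ Q L} = ⋃ L : List (Site 2), ⋃ (_ : Q L), {ω | IsLatticeWalk ω L} := by
    ext ω; simp [and_comm]
  rw [h]
  exact MeasurableSet.iUnion fun L => MeasurableSet.iUnion fun _ => measurableSet_setOf_isLatticeWalk L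

/-- `initEventGM` is measurable. [folklore] -/
theorem measurableSet_initEventGM (ρ N : ℕ) : MeasurableSet (initEventGM ρ N) :=
  measurableSet_exists_isLatticeWalk _

/-- `finalEventGM` is measurable. [folklore] -/
theorem measurableSet_finalEventGM (ρ N K : ℕ) : MeasurableSet (finalEventGM ρ N K) :=
  measurableSet_exists_isLatticeWalk _

/-- `cvInitGM` is measurable. [folklore] -/
theorem measurableSet_cvInitGM (N : ℕ) : MeasurableSet (cvInitGM N) :=
  measurableSet_exists_isLatticeWalk _

/-- `cvFinalGM` is measurable. [folklore] -/
theorem measurableSet_cvFinalGM (N u : ℕ) : MeasurableSet (cvFinalGM N u) :=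
  measurableSet_exists_isLatticeWalk _

/-! ### Locality -/

/-- The edges of `ℤ²` between the heights `lo` and `hi`. [folklore] -/
def edgesBetween (lo hi : ℤ) : Set (Sym2 (Site 2)) :=
  {e | ∀ x ∈ e, lo ≤ hgtOf x ∧ hgtOf x ≤ hi}

/-- A list walk all of whose vertices have heights in `[lo, hi]` only uses edges of
`edgesBetween lo hi`, so it is open in `ω` iff it is open in `ω ∩ edgesBetween lo hi`. [folklore] -/
theorem isLatticeWalk_iff_inter {ω : Set (Sym2 (Site 2))} {lo hi : ℤ} :
    ∀ {L : List (Site 2)}, (∀ x ∈ L, lo ≤ hgtOf x ∧ hgtOf x ≤ hi) →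
      (IsLatticeWalk ω L ↔ IsLatticeWalk (ω ∩ edgesBetween lo hi) L)
  | [], _ => Iff.rfl
  | [_], _ => Iff.rfl
  | a :: b :: l, hL => by
    have ha := hL a (by simp)
    have hb := hL b (by simp)
    have ih := isLatticeWalk_iff_inter (ω := ω) (lo := lo) (hi := hi) (L := b :: l) fun x hx => hL x (List.mem_cons_of_mem _ hx)
    have he : s(a, b) ∈ edgesBetween lo hi := by
      intro x hx
      rcases Sym2.mem_iff.1 hx with rfl | rfl
      exacts [ha, hb]
    simp only [IsLatticeWalk, Set.mem_inter_iff]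
    tauto

/-- **A walk event with height constraints is determined by the edges between those heights.**
[folklore] -/
theorem determinedBy_exists_isLatticeWalk {Q : List (Site 2) → Prop} {lo hi : ℤ}
    (hQ : ∀ L, Q L → ∀ x ∈ L, lo ≤ hgtOf x ∧ hgtOf x ≤ hi) :
    DeterminedBy {ω : Set (Sym2 (Site 2)) | ∃ L, IsLatticeWalk ω L ∧ Q L} (edgesBetween lo hi) := by
  rw [determinedBy_iff]
  intro ω ω' h
  simp only [Set.mem_setOf_eq]
  constructor
  · rintro ⟨L, hL, hq⟩
    refine ⟨L, ?_, hq⟩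
    rw [isLatticeWalk_iff_inter (hQ L hq)] at hL ⊢
    rwa [← h]
  · rintro ⟨L, hL, hq⟩
    refine ⟨L, ?_, hq⟩
    rw [isLatticeWalk_iff_inter (hQ L hq)] at hL ⊢
    rwa [h]

/-- `E_N` is determined by the edges between the heights `0` and `N`. [folklore] -/
theorem determinedBy_initEventGM (ρ N : ℕ) : DeterminedBy (initEventGM ρ N) (edgesBetween 0 N) :=
  determinedBy_exists_isLatticeWalk fun _ hq x hx => (hq.2.2 x hx).2

/-- `finalEventGM ρ N K` is determined by the edges between the heights `0` and `K`. [folklore] -/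
theorem determinedBy_finalEventGM (ρ N K : ℕ) : DeterminedBy (finalEventGM ρ N K) (edgesBetween 0 K) :=
  determinedBy_exists_isLatticeWalk fun _ hq x hx => hq.2.2 x hx

/-- `cvInitGM N` is determined by the edges between the heights `0` and `N`. [folklore] -/
theorem determinedBy_cvInitGM (N : ℕ) : DeterminedBy (cvInitGM N) (edgesBetween 0 N) :=
  determinedBy_exists_isLatticeWalk fun _ hq x hx => (hq.2.2 x hx).2

/-- `cvFinalGM N u` is determined by the edges between the heights `0` and `u`. [folklore] -/
theorem determinedBy_cvFinalGM (N u : ℕ) : DeterminedBy (cvFinalGM N u) (edgesBetween 0 u) :=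
  determinedBy_exists_isLatticeWalk fun _ hq x hx => (hq.2.2 x hx).2

/-- **`gmWeight α rows e` depends on `rows` only through the row of `e`**: if two row sequences
agree on `[lo, hi)` then the weights agree on the lattice edges between the heights `lo` and `hi`.
[cite: GrimmettManolescu2014Isoradial, §4.6] -/
theorem gmWeight_eq_of_rows (α : ℤ → ℝ) {rows rows' : ℤ → ℝ} {lo hi : ℤ}
    (h : ∀ j, lo ≤ j → j < hi → rows j = rows' j) :
    ∀ e ∈ edgesBetween lo hi, Percolation.gmWeight α rows e = Percolation.gmWeight α rows' e := by
  intro e he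
  unfold Percolation.gmWeight
  split_ifs with hE hH
  · rw [h _ (hlo e he hE) (hhi e he hE)]
  · rw [h _ (hlo e he hE) (hhi e he hE)]
  · rfl
where
  /-- the row of a lattice edge between the heights is `≥ lo` -/
  hlo : ∀ e ∈ edgesBetween lo hi, e ∈ (zdGraph 2).edgeSet → lo ≤ trackIndex e := by
    intro e he hE
    induction e using Sym2.ind with
    | _ a b =>
      rw [trackIndex_mk]
      have ha := (he a (Sym2.mem_mk_left a b)).1
      have hb := (he b (Sym2.mem_mk_right a b)).1
      simp only [hgtOf] at ha hb
      exact le_min ha hb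
  /-- and `< hi` (the two endpoints have heights differing by one) -/
  hhi : ∀ e ∈ edgesBetween lo hi, e ∈ (zdGraph 2).edgeSet → trackIndex e < hi := by
    intro e he hE
    induction e using Sym2.ind with
    | _ a b =>
      rw [trackIndex_mk]
      have ha := (he a (Sym2.mem_mk_left a b)).2
      have hb := (he b (Sym2.mem_mk_right a b)).2
      have hadj : (zdGraph 2).Adj a b := (SimpleGraph.mem_edgeSet _).1 hE
      rw [zdGraph_adj_iff] at hadj
      obtain ⟨j, hj | hj⟩ := hadj <;>
      · have h0 := congrFun hj 0
        have h1 := congrFun hj 1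
        fin_cases j <;> simp [hgtOf] at h0 h1 ha hb ⊢ <;> omega

/-- Bounded angles for a pair of sequences (GM14 (4.5) in full-angle units: all rhombi of
`G_{α,β}` have angles in `[ε, π - ε]`). [cite: GrimmettManolescu2014Isoradial, §4.6 (4.5)] -/
def AnglesIn (ε : ℝ) (α β : ℤ → ℝ) : Prop := ∀ i j, β j - α i ∈ Set.Icc ε (π - ε)

/-! ### Small tools -/

/-- Real part of the translate by `c`: column `- c`. [folklore] -/
@[simp] theorem re_zDia_sub_nat (v : Site 2) (c : ℕ) : (zDia v - ((c : ℕ) : ℂ)).re = col v - c := by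
  simp [zDia]

/-- Imaginary part of the translate by `c`: the height. [folklore] -/
@[simp] theorem im_zDia_sub_nat (v : Site 2) (c : ℕ) : (zDia v - ((c : ℕ) : ℂ)).im = hgtOf v := by
  simp [zDia]

/-- **`P_{α,β}`-almost every configuration is a lattice configuration** (`gmWeight` vanishes off
`E(ℤ²)`). [cite: GrimmettManolescu2014Isoradial, §4.6] -/
theorem prodBernoulli_gmWeight_not_subset (α β : ℤ → ℝ) :
    prodBernoulli (Percolation.gmWeight α β) {ω | ¬ ω ⊆ (zdGraph 2).edgeSet} = 0 := by
  have h : {ω : Set (Sym2 (Site 2)) | ¬ ω ⊆ (zdGraph 2).edgeSet} ⊆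
      ⋃ e : {e : Sym2 (Site 2) // e ∉ (zdGraph 2).edgeSet}, {ω | (e : Sym2 (Site 2)) ∈ ω} := by
    intro ω hω
    simp only [Set.mem_setOf_eq, Set.not_subset] at hω
    obtain ⟨e, he, hne⟩ := hω
    exact Set.mem_iUnion.2 ⟨⟨e, hne⟩, he⟩
  refine measure_mono_null h ((measure_iUnion_null_iff).2 fun e => ?_)
  have h1 := prodBernoulli_real_setOf_mem (Percolation.gmWeight α β) (e : Sym2 (Site 2))
  have h0 : Percolation.gmWeight α β (e : Sym2 (Site 2)) = 0 := by
    unfold Percolation.gmWeight; rw [if_neg e.2]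
  rw [h0] at h1
  have h2 : (prodBernoulli (Percolation.gmWeight α β)).real {ω | (e : Sym2 (Site 2)) ∈ ω} = 0 := by simpa using h1
  exact (measureReal_eq_zero_iff (measure_ne_top _ _)).1 h2

/-- Intersecting with the a.s. event `{ω ⊆ E(ℤ²)}` does not change `P_{α,β}`-probabilities. [folklore] -/
theorem measureReal_inter_subset_edgeSet (α β : ℤ → ℝ) (A : Set (Set (Sym2 (Site 2)))) :
    (prodBernoulli (Percolation.gmWeight α β)).real (A ∩ {ω | ω ⊆ (zdGraph 2).edgeSet}) =
      (prodBernoulli (Percolation.gmWeight α β)).real A := by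
  have h : prodBernoulli (Percolation.gmWeight α β) {ω : Set (Sym2 (Site 2)) | ω ⊆ (zdGraph 2).edgeSet}ᶜ = 0 :=
    prodBernoulli_gmWeight_not_subset α β
  rw [measureReal_def, measureReal_def, measure_inter_conull h]

/-! ### The three crossing events and the corner-to-corner crossing -/

/-- GM14's `C_h[B(ρN, N)]` (rendered with the tree's slack): a left–right crossing of
`[-ρN, ρN] × [0, N]`. [cite: GrimmettManolescu2014Isoradial, §6.2 (6.12)] -/
def chBox (ρ N : ℕ) : Set (Set (Sym2 (Site 2))) :=
  embRectCrossing (fun v => zDia v - (-((ρ * N : ℕ) : ℂ))) (2 * (ρ * N : ℕ)) N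

/-- GM14's `C_v[B(-ρN, -(ρ-1)N; 0, N)]`: a top–bottom crossing of the left end square. [cite: GrimmettManolescu2014Isoradial, §6.2 (6.12)] -/
def cvLeft (ρ N : ℕ) : Set (Set (Sym2 (Site 2))) :=
  embTBCrossing (fun v => zDia v - (-((ρ * N : ℕ) : ℂ))) N N

/-- GM14's `C_v[B((ρ-1)N, ρN; 0, N)]`: a top–bottom crossing of the right end square. [cite: GrimmettManolescu2014Isoradial, §6.2 (6.12)] -/
def cvRight (ρ N : ℕ) : Set (Set (Sym2 (Site 2))) :=
  embTBCrossing (fun v => zDia v - (((ρ - 1) * N : ℕ) : ℂ)) N N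

/-- GM14's `E_N` as an open crossing of `B(ρN, N)` between its bottom corners. [cite: GrimmettManolescu2014Isoradial, §6.2 (E_N)] -/
def cornerCrossing (ρ N : ℕ) : Set (Set (Sym2 (Site 2))) :=
  openCrossing {v : Site 2 | |col v| ≤ ((ρ * N : ℕ) : ℤ) ∧ 0 ≤ hgtOf v ∧ hgtOf v ≤ N}
    {v | hgtOf v = 0 ∧ -((ρ * N : ℕ) : ℤ) ≤ col v ∧ col v ≤ -(((ρ - 1) * N : ℕ) : ℤ)}
    {v | hgtOf v = 0 ∧ (((ρ - 1) * N : ℕ) : ℤ) ≤ col v ∧ col v ≤ ((ρ * N : ℕ) : ℤ)}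

/-- **Planar gluing (GM14 (6.12), deterministic part).** On a lattice configuration, `C_h[B(ρN,N)]`,
`C_v` of the left end square and `C_v` of the right end square together give an open path of
`B(ρN, N)` between its two bottom corners. [cite: GrimmettManolescu2014Isoradial, §6.2 (6.12)] -/
theorem cornerCrossing_of_three {ρ N : ℕ} (hρ : 1 ≤ ρ) (hN : 1 ≤ N) {ω : Set (Sym2 (Site 2))}
    (hω : ω ⊆ (zdGraph 2).edgeSet) (hH : ω ∈ chBox ρ N) (hL : ω ∈ cvLeft ρ N) (hR : ω ∈ cvRight ρ N) :
    ω ∈ cornerCrossing ρ N := by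
  -- linearise the two products `ρN`, `(ρ-1)N`
  have hKL : ρ * N = (ρ - 1) * N + N := by
    obtain ⟨r, rfl⟩ : ∃ r, ρ = r + 1 := ⟨ρ - 1, by omega⟩
    simp [add_mul]
  unfold chBox at hH
  unfold cvLeft at hL
  unfold cvRight at hR
  unfold cornerCrossing
  generalize hK : (ρ - 1) * N = K at *
  generalize hL' : ρ * N = L at *
  have hN0 : (0 : ℤ) < N := by exact_mod_cast hN
  set B : Set (Site 2) := {v | |col v| ≤ (L : ℤ) ∧ 0 ≤ hgtOf v ∧ hgtOf v ≤ N} with hB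
  set BL : Set (Site 2) := {v | -(L : ℤ) ≤ col v ∧ col v ≤ -(K : ℤ) ∧ 0 ≤ hgtOf v ∧ hgtOf v ≤ N} with hBL
  set BR : Set (Site 2) := {v | (K : ℤ) ≤ col v ∧ col v ≤ L ∧ 0 ≤ hgtOf v ∧ hgtOf v ≤ N} with hBR
  have hBLB : BL ⊆ B := fun v hv => by
    obtain ⟨h1, h2, h3⟩ := hv
    exact ⟨abs_le.2 ⟨h1, by omega⟩, h3⟩
  have hBRB : BR ⊆ B := fun v hv => by
    obtain ⟨h1, h2, h3⟩ := hv
    exact ⟨abs_le.2 ⟨by omega, h2⟩, h3⟩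
  -- (1) the horizontal crossing, clipped to the columns `[-L, L]`
  obtain ⟨x, hx, y, hy, hxy⟩ := hH
  simp only [Set.mem_setOf_eq, re_zDia_sub_neg] at hx hy
  have ix : col x + L ≤ (0 : ℤ) := by exact_mod_cast hx
  have iy : (2 * L : ℤ) ≤ col y + L := by exact_mod_cast hy
  obtain ⟨xH, yH, hxH, hyH, hconnH⟩ := exists_openConnIn_clip hω col col_le_of_adj (a := -(L : ℤ)) (b := L)
    (by omega) (by omega) (by omega) hxy
  have hH' : ω ∈ openConnIn B xH yH := by
    refine openConnIn_mono (fun v hv => ?_) _ _ hconnH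
    obtain ⟨⟨-, him⟩, h1, h2⟩ := hv
    simp only [im_zDia_sub_neg, Set.mem_Icc] at him
    exact ⟨abs_le.2 ⟨h1, h2⟩, by exact_mod_cast him.1, by exact_mod_cast him.2⟩
  -- (2) the left vertical crossing, clipped to the heights `[0, N]`
  obtain ⟨x, hx, y, hy, hxy⟩ := hL
  simp only [Set.mem_setOf_eq, im_zDia_sub_neg] at hx hy
  obtain ⟨xL, yL, hxL, hyL, hconnL⟩ := exists_openConnIn_clip hω hgtOf hgtOf_le_of_adj (a := 0) (b := N)
    (by omega) (by exact_mod_cast hx) (by exact_mod_cast hy) hxy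
  have hL2 : ω ∈ openConnIn BL xL yL := by
    refine openConnIn_mono (fun v hv => ?_) _ _ hconnL
    obtain ⟨⟨hre, -⟩, h1, h2⟩ := hv
    simp only [re_zDia_sub_neg, Set.mem_Icc] at hre
    have i1 : (0 : ℤ) ≤ col v + L := by exact_mod_cast hre.1
    have i2 : col v + L ≤ (N : ℤ) := by exact_mod_cast hre.2
    exact ⟨by omega, by omega, h1, h2⟩
  -- (3) the right vertical crossing
  obtain ⟨x, hx, y, hy, hxy⟩ := hR
  simp only [Set.mem_setOf_eq, im_zDia_sub_nat] at hx hy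
  obtain ⟨xR, yR, hxR, hyR, hconnR⟩ := exists_openConnIn_clip hω hgtOf hgtOf_le_of_adj (a := 0) (b := N)
    (by omega) (by exact_mod_cast hx) (by exact_mod_cast hy) hxy
  have hR2 : ω ∈ openConnIn BR xR yR := by
    refine openConnIn_mono (fun v hv => ?_) _ _ hconnR
    obtain ⟨⟨hre, -⟩, h1, h2⟩ := hv
    simp only [re_zDia_sub_nat, Set.mem_Icc] at hre
    have i1 : (0 : ℤ) ≤ col v - K := by exact_mod_cast hre.1
    have i2 : col v - K ≤ (N : ℤ) := by exact_mod_cast hre.2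
    exact ⟨by omega, by omega, h1, h2⟩
  -- (4) glue `H` with `L` and with `R` in the straight drawing `G_{0,π/2}`
  have hz := zDia_eq_gmEmbedding_z
  have hzre : ∀ v : Site 2, ((gmEmbedding (fun _ => (0 : ℝ)) (fun _ => π / 2)).z v).re = col v := fun v => by
    rw [hz, zDia_re]
  have hzim : ∀ v : Site 2, ((gmEmbedding (fun _ => (0 : ℝ)) (fun _ => π / 2)).z v).im = hgtOf v := fun v => by
    rw [hz, zDia_im]
  have hSB : ∀ v ∈ B, ((gmEmbedding (fun _ => (0 : ℝ)) (fun _ => π / 2)).z v).im ∈ Set.Icc (0 : ℝ) N := fun v hv => by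
    rw [hzim]; exact ⟨by exact_mod_cast hv.2.1, by exact_mod_cast hv.2.2⟩
  have gl := exists_common_vertex_of_openCrossing (emb := gmEmbedding (fun _ => (0 : ℝ)) (fun _ => π / 2))
    isIsoradial_dia isRhombicTiling_dia hω (S := B) (A := {xH}) (B := {yH}) (S' := BL) (A' := {xL}) (B' := {yL})
    (a₁ := -(L : ℝ)) (a₂ := -(K : ℝ)) (c₁ := 0) (c₂ := N)
    (by have : -(L : ℤ) < -K := by omega
        exact_mod_cast this)
    (by exact_mod_cast hN0) hSB
    (fun v (hv : v ∈ ({xH} : Set (Site 2))) => by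
      rw [Set.mem_singleton_iff.1 hv, hzre]; exact_mod_cast hxH.le)
    (fun v (hv : v ∈ ({yH} : Set (Site 2))) => by
      rw [Set.mem_singleton_iff.1 hv, hzre]
      have : -(K : ℤ) ≤ col yH := by omega
      exact_mod_cast this)
    (fun v hv => by rw [hzre]; exact ⟨by exact_mod_cast hv.1, by exact_mod_cast hv.2.1⟩)
    (fun v (hv : v ∈ ({xL} : Set (Site 2))) => by
      rw [Set.mem_singleton_iff.1 hv, hzim]; exact_mod_cast hxL.le)
    (fun v (hv : v ∈ ({yL} : Set (Site 2))) => by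
      rw [Set.mem_singleton_iff.1 hv, hzim]; exact_mod_cast hyL.ge)
    ⟨xH, rfl, yH, rfl, hH'⟩ ⟨xL, rfl, yL, rfl, hL2⟩
  obtain ⟨v, -, -, ⟨x₁, hx₁, hxHv⟩, -, ⟨x₂, hx₂, hxLv⟩, -⟩ := gl
  have hxHv' : ω ∈ openConnIn B xH v := (Set.mem_singleton_iff.1 hx₁) ▸ hxHv
  have hxLv' : ω ∈ openConnIn BL xL v := (Set.mem_singleton_iff.1 hx₂) ▸ hxLv
  have gr := exists_common_vertex_of_openCrossing (emb := gmEmbedding (fun _ => (0 : ℝ)) (fun _ => π / 2))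
    isIsoradial_dia isRhombicTiling_dia hω (S := B) (A := {xH}) (B := {yH}) (S' := BR) (A' := {xR}) (B' := {yR})
    (a₁ := (K : ℝ)) (a₂ := (L : ℝ)) (c₁ := 0) (c₂ := N)
    (by have : (K : ℤ) < L := by omega
        exact_mod_cast this)
    (by exact_mod_cast hN0) hSB
    (fun v (hv : v ∈ ({xH} : Set (Site 2))) => by
      rw [Set.mem_singleton_iff.1 hv, hzre]
      have : col xH ≤ (K : ℤ) := by omega
      exact_mod_cast this)
    (fun v (hv : v ∈ ({yH} : Set (Site 2))) => by
      rw [Set.mem_singleton_iff.1 hv, hzre]; exact_mod_cast hyH.ge)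
    (fun v hv => by rw [hzre]; exact ⟨by exact_mod_cast hv.1, by exact_mod_cast hv.2.1⟩)
    (fun v (hv : v ∈ ({xR} : Set (Site 2))) => by
      rw [Set.mem_singleton_iff.1 hv, hzim]; exact_mod_cast hxR.le)
    (fun v (hv : v ∈ ({yR} : Set (Site 2))) => by
      rw [Set.mem_singleton_iff.1 hv, hzim]; exact_mod_cast hyR.ge)
    ⟨xH, rfl, yH, rfl, hH'⟩ ⟨xR, rfl, yR, rfl, hR2⟩
  obtain ⟨v', -, -, ⟨x₃, hx₃, hxHv3⟩, -, ⟨x₄, hx₄, hxRv4⟩, -⟩ := gr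
  have hxHw : ω ∈ openConnIn B xH v' := (Set.mem_singleton_iff.1 hx₃) ▸ hxHv3
  have hxRw : ω ∈ openConnIn BR xR v' := (Set.mem_singleton_iff.1 hx₄) ▸ hxRv4
  -- (5) chain: xL → v → xH → v' → xR inside B
  have c1 : ω ∈ openConnIn B xL v := openConnIn_mono hBLB _ _ hxLv'
  have c2 : ω ∈ openConnIn B v xH := by rw [openConnIn_comm]; exact hxHv'
  have c4 : ω ∈ openConnIn B v' xR := by rw [openConnIn_comm]; exact openConnIn_mono hBRB _ _ hxRw
  have hconn := GM.openConnIn_trans (GM.openConnIn_trans (GM.openConnIn_trans c1 c2) hxHw) c4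
  have hxLm : xL ∈ BL := hL2.1
  have hxRm : xR ∈ BR := hR2.1
  exact ⟨xL, ⟨hxL, hxLm.1, hxLm.2.1⟩, xR, ⟨hxR, hxRm.1, hxRm.2.1⟩, hconn⟩

/-! ### (6.12): Harris -/

/-- The three events are increasing and measurable. [folklore] -/
theorem measurableSet_chBox (ρ N : ℕ) : MeasurableSet (chBox ρ N) :=
  IsoradialArmExtension.measurableSet_embRectCrossing _ _ _

/-- `cvLeft` is measurable. [folklore] -/
theorem measurableSet_cvLeft (ρ N : ℕ) : MeasurableSet (cvLeft ρ N) :=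
  IsoradialArmExtension.measurableSet_embTBCrossing _ _ _

/-- `cvRight` is measurable. [folklore] -/
theorem measurableSet_cvRight (ρ N : ℕ) : MeasurableSet (cvRight ρ N) :=
  IsoradialArmExtension.measurableSet_embTBCrossing _ _ _

/-- **GM14 (6.12)**: for every isoradial square lattice measure `P_{α,β}` and `ρ, N ≥ 1`,
`P(C_h[B(ρN,N)]) · P(C_v^L) · P(C_v^R) ≤ P(E_N)` with `E_N = initEventGM ρ N` (Harris' inequality
for the three increasing crossing events, then the planar gluing `cornerCrossing_of_three` on the
a.s. lattice configurations). [cite: GrimmettManolescu2014Isoradial, §6.2 (6.12)] -/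
theorem prod_three_le_measureReal_initEventGM (α β : ℤ → ℝ) {ρ N : ℕ} (hρ : 1 ≤ ρ) (hN : 1 ≤ N) :
    (prodBernoulli (Percolation.gmWeight α β)).real (chBox ρ N) *
        (prodBernoulli (Percolation.gmWeight α β)).real (cvLeft ρ N) *
        (prodBernoulli (Percolation.gmWeight α β)).real (cvRight ρ N) ≤
      (prodBernoulli (Percolation.gmWeight α β)).real (initEventGM ρ N) := by
  classical
  set P := prodBernoulli (Percolation.gmWeight α β) with hP
  -- Harris for the three events, indexed by `Fin 3`
  let A : Fin 3 → Set (Set (Sym2 (Site 2))) := ![chBox ρ N, cvLeft ρ N, cvRight ρ N]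
  have hA : ∀ k ∈ (Finset.univ : Finset (Fin 3)), IsUpperSet (A k) := by
    intro k _; fin_cases k
    · exact isUpperSet_embRectCrossing _ _ _
    · exact isUpperSet_embTBCrossing _ _ _
    · exact isUpperSet_embTBCrossing _ _ _
  have hAm : ∀ k ∈ (Finset.univ : Finset (Fin 3)), MeasurableSet (A k) := by
    intro k _; fin_cases k
    · exact measurableSet_chBox ρ N
    · exact measurableSet_cvLeft ρ N
    · exact measurableSet_cvRight ρ N
  have harris := prodBernoulli_prod_le_real_iInter_of_isUpperSet (Percolation.gmWeight α β) Finset.univ hA hAm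
  rw [Fin.prod_univ_three] at harris
  simp only [A, Matrix.cons_val_zero, Matrix.cons_val_one, Matrix.cons_val] at harris
  refine harris.trans ?_
  -- the intersection, on lattice configurations, is contained in `E_N`
  rw [← measureReal_inter_subset_edgeSet α β]
  refine measureReal_mono (fun ω hω => ?_) (measure_ne_top _ _)
  obtain ⟨hI, hE⟩ := hω
  have h3 : ∀ k : Fin 3, ω ∈ A k := by
    intro k; exact Set.mem_iInter₂.1 hI k (Finset.mem_univ k)
  have hH : ω ∈ chBox ρ N := h3 0
  have hL : ω ∈ cvLeft ρ N := h3 1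
  have hR : ω ∈ cvRight ρ N := h3 2
  exact openCrossing_subset_initEventGM ρ N hE (cornerCrossing_of_three hρ hN hE hH hL hR)

end TrackExchange

end Literature.Probability.Percolation
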